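import Summits.AnomalousDissipation.AnomalousDissipation.Theses.EnsembleRigidity
import Summits.AnomalousDissipation.AnomalousDissipation.Theorems.TaylorCertificatesEnsembleCeilingTransfer
import Literature.Analysis.FluidPDE.TimeAverageEnstrophy
import Literature.Analysis.FluidPDE.ZerothLawProofs
import HarnessLib

/-!
# Route EnsembleRigidity — the crux `EnsembleFloorTransfer`

Proof of the route declaration
`Summit.AnomalousDissipation.AnomalousDissipation.Theses.EnsembleRigidity.EnsembleFloorTransfer`
(item stmt-AnomalousDissipation-15511): ENSEMBLE FLOOR ⇒ PATH FLOOR, the dissipation twin of the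
proved `TaylorCertificates.EnsembleCeilingTransfer`
(`Theorems/TaylorCertificatesEnsembleCeilingTransfer.lean`). For `ν > 0` and a smooth force `f` on
`T³`: if every stationary statistical solution `μ` of NS_ν(f) (FMRT 2001, Ch. IV Def. 1.3) with
integrable energy and `ensembleEnergy μ ≤ E` has `ensembleDissipation ν μ ≥ ε₀`, then every global
Leray–Hopf path `u` with an `H`-valued lift `U` (`U t = u t` a.e., `t ≥ 0`) and `meanEnergy u ≤ E`
has `meanDissipation ν u ≥ ε₀`.

Proof (Foias–Manley–Rosa–Temam 2001, Ch. IV §3.1, with the generalized limit KEPT in (3.3) instead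
of being replaced by the a priori constant (3.4)); line `lim-valued-enstrophy-bound` of the crux
chain (planner sketch `Cruxes/EnsembleFloorTransfer/IdeaLimValuedEnstrophyBoundSketch.lean`):

* `integral_min_galerkinEnstrophy_le_longTimeAvg`: for a time-average measure `μ` of the lift `U`
  w.r.t. a generalized limit `Λ`, `∫ min(‖∇P_m v‖², M) dμ = Λ(time means of min(‖∇P_m U‖², M))
  ≤ Λ(T ↦ T⁻¹∫₀ᵀ ‖∇u‖²)` by MONOTONICITY of `Λ` on eventually bounded functions
  (`GeneralizedLimit.apply_mono`), the majorant having bounded time means by (3.4)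
  (`Torus.IsGlobalLerayHopf.timeMean_enstrophy_le`);
* `ensembleEnstrophy_le_ofReal_longTimeAvg`: `∫ ‖∇v‖² dμ ≤ Λ(T ↦ T⁻¹∫₀ᵀ ‖∇u‖²)` by monotone
  convergence in the cap `M` and Fatou in the truncation `m` (the pattern of the tree's
  `Torus.IsTimeAverageMeasure.lintegral_eGradNormSq_le`);
* `meanDissipation_ge_of_ensembleFloor_of_generalizedLimit`: the time-average measure `μ` of `U`
  for `Λ` (`Theorems.exists_isTimeAverageMeasure_of_memLp`) is an SSS (the three proved conjuncts of
  `Torus.IsTimeAverageMeasure`), `‖v‖²` is `μ`-integrable with `ensembleEnergy μ = Λ(energy means)`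
  (`Torus.IsTimeAverageMeasure.integral_eq_of_eqOn` on the carrying ball
  `Torus.IsGlobalLerayHopf.exists_forall_lift_mem_closedBall`); if `Λ(energy means) ≤ E` the floor
  fires at `μ`, and `ε₀ ≤ ensembleDissipation ν μ = ν (∫‖∇v‖²dμ).toReal ≤ ν Λ(enstrophy means)
  ≤ ν limsup(enstrophy means) = meanDissipation ν u` (`GeneralizedLimit.le_limsup`,
  `longTimeAvgSup_const_mul`);
* `meanDissipation_ge_of_ensembleFloor`: ANY generalized limit works, since
  `Λ(energy means) ≤ limsup = meanEnergy u ≤ E`.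

The route declaration `EnsembleFloorTransfer_proof` is the specialisation to a smooth force
(`Torus.IsSmooth.memLp`); its hypotheses `IsDivFree f`, `HasZeroMean f` are not needed (the force
enters the time-average theory only through `f ∈ L²`).

## References

* C. Foias, O. Manley, R. Rosa, R. Temam, *Navier–Stokes Equations and Turbulence* (CUP 2001),
  Ch. IV §1.3 Def. 1.4 (generalized limits), §3.1 Def. 3.1, Prop. 3.1, Cor. 3.1, Thm. 3.1 and the
  proof of (1.29) via (3.3)–(3.4), pp. 208–211. [FoiasManleyRosaTemam2001]
* C. R. Doering, C. Foias, J. Fluid Mech. 467 (2002), §2. [DoeringFoias2002]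
-/

noncomputable section

open MeasureTheory Set Filter Topology
open scoped ENNReal NNReal

-- `Summit.<Summit>.<Problem>` is the tree's mandated summit-side namespace (CONVENTIONS §2); for
-- this single-conjunct summit the two coincide, so the duplicate is deliberate.
set_option linter.dupNamespace false

namespace Summit.AnomalousDissipation.AnomalousDissipation.Theorems

open Literature.Analysis Literature.Analysis.FluidPDE Literature.Analysis.FunctionSpaces
open Literature.Analysis.FluidPDE.Torus

variable {d : Type*} [Fintype d] [DecidableEq d]

/-! ### First lemma (a): the capped Galerkin enstrophy has μ-mean ≤ Λ(time means of ‖∇u‖²) -/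

/-- FMRT (3.3), Λ-valued: `∫ min(‖P_m v‖², M) dμ = Λ(T⁻¹∫₀ᵀ min(‖P_m U‖², M)) ≤ Λ(T⁻¹∫₀ᵀ ‖∇u‖²)`
by MONOTONICITY of `Λ` on eventually bounded functions (`GeneralizedLimit.apply_mono`); the upper
function has bounded time means by (3.4) (`IsGlobalLerayHopf.timeMean_enstrophy_le`). -/
theorem integral_min_galerkinEnstrophy_le_longTimeAvg {ν : ℝ} (hν : 0 < ν)
    {F u₀ : UnitAddTorus d → EuclideanSpace ℝ d} (hF : MemLp F 2 volume)
    {u : ℝ → UnitAddTorus d → EuclideanSpace ℝ d} (hu : IsGlobalLerayHopf ν (fun _ => F) u₀ u)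
    {U : ℝ → FunctionSpaces.Torus.energySpace d}
    (hU : ∀ t, 0 ≤ t → ((U t : Lp (EuclideanSpace ℝ d) 2 (volume : Measure (UnitAddTorus d))) :
      UnitAddTorus d → EuclideanSpace ℝ d) =ᵐ[volume] u t)
    {Λ : GeneralizedLimit} {μ : Measure (FunctionSpaces.Torus.energySpace d)}
    (hμ : IsTimeAverageMeasure Λ.longTimeAvg U μ) (m : ℕ) {M : ℝ} (hM : 0 ≤ M) :
    ∫ v, min (galerkinEnstrophy m v) M ∂μ ≤
      Λ.longTimeAvg (fun t => (FunctionSpaces.Torus.eGradNormSq (u t)).toReal) := by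
  set k : ℝ → ℝ := fun t => (FunctionSpaces.Torus.eGradNormSq (u t)).toReal with hk
  have habs : ∀ v : FunctionSpaces.Torus.energySpace d, |min (galerkinEnstrophy m v) M| ≤ M :=
    fun v => by
      rw [abs_of_nonneg (le_min (galerkinEnstrophy_nonneg m v) hM)]
      exact min_le_right _ _
  rw [hμ.integral_eq ((continuous_galerkinEnstrophy m).min continuous_const) habs]
  -- the majorant along the path: `min(‖P_m U t‖², M) ≤ ‖∇u(t)‖²` for a.e. `t > 0`
  have hmaj : ∀ᵐ t ∂volume, 0 < t → min (galerkinEnstrophy m (U t)) M ≤ k t := by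
    filter_upwards [hu.ae_eGradNormSq_lt_top] with t ht ht0
    refine (min_le_left _ _).trans ?_
    have hfin := ht ht0
    rw [← eGradNormSq_coe_lift hU ht0.le] at hfin
    have h := ofReal_galerkinEnstrophy_le_eGradNormSq m (U t)
    simp only [hk]
    rw [← eGradNormSq_coe_lift hU ht0.le]
    exact (ENNReal.ofReal_le_iff_le_toReal hfin.ne).1 h
  -- bounded time means of `k` ((3.4)), and of the capped observable
  have hkb : IsBoundedUnder (· ≤ ·) atTop (timeMean k) :=
    ⟨_, (eventually_ge_atTop 1).mono fun T hT => hu.timeMean_enstrophy_le hν hF hU hT⟩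
  refine Λ.apply_mono (isBoundedUnder_ge_timeMean fun t _ => habs _) hkb ?_
  filter_upwards [eventually_gt_atTop 0] with T hT
  unfold timeMean
  rw [intervalIntegral.integral_of_le hT.le, intervalIntegral.integral_of_le hT.le]
  refine mul_le_mul_of_nonneg_left ?_ (inv_nonneg.2 hT.le)
  refine integral_mono_of_nonneg (ae_of_all _ fun t => le_min (galerkinEnstrophy_nonneg _ _) hM)
    (hu.integrableOn_toReal_eGradNormSq hT).1 ?_
  filter_upwards [ae_restrict_mem measurableSet_Ioc, ae_restrict_of_ae hmaj] with t ht hkt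
  exact hkt ht.1

/-! ### First lemma (b): FIRST LEMMA OF THE CARD — Λ-valued mean-enstrophy bound (3.3) -/

/-- **First lemma.** `∫ ‖∇v‖² dμ ≤ Λ(T ↦ T⁻¹ ∫₀ᵀ ‖∇u‖²)` for every time-average measure `μ` of the
lift of a global Leray–Hopf path (monotone convergence in the cap `M`, Fatou in the truncation `m`,
exactly as the tree's `IsTimeAverageMeasure.lintegral_eGradNormSq_le` but with the Λ-value in place
of the a priori constant). -/
theorem ensembleEnstrophy_le_ofReal_longTimeAvg {ν : ℝ} (hν : 0 < ν)
    {F u₀ : UnitAddTorus d → EuclideanSpace ℝ d} (hF : MemLp F 2 volume)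
    {u : ℝ → UnitAddTorus d → EuclideanSpace ℝ d} (hu : IsGlobalLerayHopf ν (fun _ => F) u₀ u)
    {U : ℝ → FunctionSpaces.Torus.energySpace d}
    (hU : ∀ t, 0 ≤ t → ((U t : Lp (EuclideanSpace ℝ d) 2 (volume : Measure (UnitAddTorus d))) :
      UnitAddTorus d → EuclideanSpace ℝ d) =ᵐ[volume] u t)
    {Λ : GeneralizedLimit} {μ : Measure (FunctionSpaces.Torus.energySpace d)}
    (hμ : IsTimeAverageMeasure Λ.longTimeAvg U μ) :
    ensembleEnstrophy μ ≤ ENNReal.ofReal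
      (Λ.longTimeAvg (fun t => (FunctionSpaces.Torus.eGradNormSq (u t)).toReal)) := by
  haveI := hμ.1
  set B : ℝ := Λ.longTimeAvg (fun t => (FunctionSpaces.Torus.eGradNormSq (u t)).toReal) with hB
  have htrunc : ∀ m, ∫⁻ v, ENNReal.ofReal (galerkinEnstrophy m v) ∂μ ≤ ENNReal.ofReal B := by
    intro m
    set f : ℕ → FunctionSpaces.Torus.energySpace d → ℝ≥0∞ := fun M v =>
      ENNReal.ofReal (min (galerkinEnstrophy m v) M) with hf
    have hf_meas : ∀ M, Measurable (f M) := fun M =>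
      ENNReal.measurable_ofReal.comp
        ((continuous_galerkinEnstrophy m).min continuous_const).measurable
    have hf_mono : Monotone f := fun M M' hMM' v =>
      ENNReal.ofReal_le_ofReal (min_le_min_left _ (by exact_mod_cast hMM'))
    have hsup : ∀ v, (⨆ M, f M v) = ENNReal.ofReal (galerkinEnstrophy m v) := by
      intro v
      refine le_antisymm (iSup_le fun M => ENNReal.ofReal_le_ofReal (min_le_left _ _)) ?_
      refine le_iSup_of_le ⌈galerkinEnstrophy m v⌉₊ (le_of_eq ?_)
      simp only [hf]
      rw [min_eq_left (Nat.le_ceil _)]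
    calc ∫⁻ v, ENNReal.ofReal (galerkinEnstrophy m v) ∂μ = ∫⁻ v, ⨆ M, f M v ∂μ :=
          lintegral_congr fun v => (hsup v).symm
      _ = ⨆ M, ∫⁻ v, f M v ∂μ := lintegral_iSup hf_meas hf_mono
      _ ≤ ENNReal.ofReal B := iSup_le fun M => by
          have hint : Integrable (fun v => min (galerkinEnstrophy m v) (M : ℝ)) μ :=
            Integrable.of_bound
              ((continuous_galerkinEnstrophy m).min continuous_const).aestronglyMeasurable M
              (ae_of_all _ fun v => by
                rw [Real.norm_eq_abs, abs_of_nonneg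
                  (le_min (galerkinEnstrophy_nonneg m v) (Nat.cast_nonneg M))]
                exact min_le_right _ _)
          simp only [hf]
          rw [← ofReal_integral_eq_lintegral_ofReal hint
            (ae_of_all _ fun v => le_min (galerkinEnstrophy_nonneg m v) (Nat.cast_nonneg M))]
          exact ENNReal.ofReal_le_ofReal
            (integral_min_galerkinEnstrophy_le_longTimeAvg hν hF hu hU hμ m (Nat.cast_nonneg M))
  have hmeas : ∀ m, AEMeasurable (fun v => ENNReal.ofReal (galerkinEnstrophy m v)) μ := fun m =>
    (ENNReal.measurable_ofReal.comp (continuous_galerkinEnstrophy m).measurable).aemeasurable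
  unfold ensembleEnstrophy
  calc ∫⁻ v, FunctionSpaces.Torus.eGradNormSq
        ((v : Lp (EuclideanSpace ℝ d) 2 (volume : Measure (UnitAddTorus d))) :
          UnitAddTorus d → EuclideanSpace ℝ d) ∂μ
      = ∫⁻ v, liminf (fun m => ENNReal.ofReal (galerkinEnstrophy m v)) atTop ∂μ :=
        lintegral_congr fun v => ((tendsto_ofReal_galerkinEnstrophy v).liminf_eq).symm
    _ ≤ liminf (fun m => ∫⁻ v, ENNReal.ofReal (galerkinEnstrophy m v) ∂μ) atTop :=
        lintegral_liminf_le' hmeas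
    _ ≤ ENNReal.ofReal B := liminf_le_of_le (by isBoundedDefault) fun b hb =>
        (hb.and (Eventually.of_forall htrunc)).exists.elim fun m hm => hm.1.trans hm.2

/-! ### Second lemma: the transfer for a steady `L²` force (twin of
`Theorems.meanEnergy_le_of_ensembleCeiling`), in a Λ-parametrised core form -/

/-- **Core transfer, one generalized limit `Λ` fixed.** If the ensemble floor holds at level `E` and
`Λ` assigns the energy means of the lift a value `≤ E`, then `ε₀ ≤ meanDissipation ν u`. -/
theorem meanDissipation_ge_of_ensembleFloor_of_generalizedLimit {ν E ε₀ : ℝ} (hν : 0 < ν)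
    {f u₀ : UnitAddTorus (Fin 3) → EuclideanSpace ℝ (Fin 3)} (hF : MemLp f 2 volume)
    (hfloor : ∀ μ : Measure (FunctionSpaces.Torus.energySpace (Fin 3)),
      IsStationaryStatisticalSolution ν f μ →
        Integrable (fun v : FunctionSpaces.Torus.energySpace (Fin 3) => ‖v‖ ^ 2) μ →
          ensembleEnergy μ ≤ E → ε₀ ≤ ensembleDissipation ν μ)
    {u : ℝ → UnitAddTorus (Fin 3) → EuclideanSpace ℝ (Fin 3)}
    (hu : IsGlobalLerayHopf ν (fun _ => f) u₀ u)
    {U : ℝ → FunctionSpaces.Torus.energySpace (Fin 3)}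
    (hU : ∀ t, 0 ≤ t →
      (((U t : Lp (EuclideanSpace ℝ (Fin 3)) 2 (volume : Measure (UnitAddTorus (Fin 3)))) :
        UnitAddTorus (Fin 3) → EuclideanSpace ℝ (Fin 3))) =ᵐ[volume] u t)
    (Λ : GeneralizedLimit) (hΛE : Λ (timeMean fun s => ‖U s‖ ^ 2) ≤ E) :
    ε₀ ≤ meanDissipation ν u := by
  -- the carrying ball
  obtain ⟨ρ, hρ0, hρ⟩ := hu.exists_forall_lift_mem_closedBall hν hF hU
  have hball : ∀ t, 0 ≤ t → ‖U t‖ ^ 2 ≤ ρ := fun t ht => (hρ t ht).1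
  -- a time-average measure for `Λ`, which is an SSS of NS_ν(f)
  obtain ⟨μ, hμ⟩ :=
    Summit.AnomalousDissipation.AnomalousDissipation.Theorems.exists_isTimeAverageMeasure_of_memLp
      hν hF hu hU Λ
  have hstat : IsStationaryStatisticalSolution ν f μ :=
    ⟨hμ.1, IsTimeAverageMeasure.lintegral_eGradNormSq_lt_top hν hF hu hU hμ,
      fun Φ => IsTimeAverageMeasure.integrable_generator_and_integral_eq_zero hν hF hu hU hμ Φ,
      fun e₁ e₂ he => IsTimeAverageMeasure.energy_ineq_shell hν hF hu hU hμ e₁ e₂ he⟩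
  -- energy side: integrable, and `ensembleEnergy μ = Λ(energy means) ≤ E`
  have hKc : IsClosed {v : FunctionSpaces.Torus.energySpace (Fin 3) | ‖v‖ ^ 2 ≤ ρ} :=
    isClosed_le (continuous_norm.pow 2) continuous_const
  have hUK : ∀ t, 0 ≤ t → U t ∈ {v : FunctionSpaces.Torus.energySpace (Fin 3) | ‖v‖ ^ 2 ≤ ρ} :=
    fun t ht => hball t ht
  have hΨc : Continuous fun v : FunctionSpaces.Torus.energySpace (Fin 3) => min (‖v‖ ^ 2) ρ :=
    (continuous_norm.pow 2).min continuous_const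
  have hΨb : ∀ v : FunctionSpaces.Torus.energySpace (Fin 3), |min (‖v‖ ^ 2) ρ| ≤ ρ := fun v => by
    rw [abs_of_nonneg (le_min (sq_nonneg _) hρ0)]
    exact min_le_right _ _
  have heq : EqOn (fun v : FunctionSpaces.Torus.energySpace (Fin 3) => ‖v‖ ^ 2)
      (fun v => min (‖v‖ ^ 2) ρ) {v | ‖v‖ ^ 2 ≤ ρ} := fun v hv => (min_eq_left hv).symm
  obtain ⟨hint, hI⟩ := hμ.integral_eq_of_eqOn hKc hUK hΨc hΨb heq
  have h1 : ensembleEnergy μ = Λ (timeMean fun s => ‖U s‖ ^ 2) := hI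
  have hEμ : ensembleEnergy μ ≤ E := h1 ▸ hΛE
  -- the floor, instantiated at `μ`
  have hfl : ε₀ ≤ ensembleDissipation ν μ := hfloor μ hstat hint hEμ
  -- dissipation side:
  -- `ν ∫‖∇v‖² dμ ≤ ν Λ(enstrophy means) ≤ ν limsup(enstrophy means) = meanDissipation`
  set k : ℝ → ℝ := fun t => (FunctionSpaces.Torus.eGradNormSq (u t)).toReal with hk
  have hle : ensembleEnstrophy μ ≤ ENNReal.ofReal (Λ.longTimeAvg k) :=
    ensembleEnstrophy_le_ofReal_longTimeAvg hν hF hu hU hμ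
  have hkb₁ : IsBoundedUnder (· ≤ ·) atTop (timeMean k) :=
    ⟨_, (eventually_ge_atTop 1).mono fun T hT => hu.timeMean_enstrophy_le hν hF hU hT⟩
  have hk0 : ∀ᶠ T in atTop, 0 ≤ timeMean k T := by
    filter_upwards [eventually_gt_atTop 0] with T hT
    unfold timeMean
    exact mul_nonneg (inv_nonneg.2 hT.le)
      (intervalIntegral.integral_nonneg hT.le fun t _ => ENNReal.toReal_nonneg)
  have hkb₂ : IsBoundedUnder (· ≥ ·) atTop (timeMean k) := ⟨0, hk0⟩
  have hΛ0 : 0 ≤ Λ.longTimeAvg k := Λ.le_apply_of_eventually_le hkb₁ hk0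
  have hΛk : Λ.longTimeAvg k ≤ longTimeAvgSup k := Λ.le_limsup hkb₁ hkb₂
  have htoReal : (ensembleEnstrophy μ).toReal ≤ Λ.longTimeAvg k :=
    ENNReal.toReal_le_of_le_ofReal hΛ0 hle
  have hdiss : meanDissipation ν u = ν * longTimeAvgSup k := by
    unfold meanDissipation
    exact longTimeAvgSup_const_mul hν.le k
  calc ε₀ ≤ ensembleDissipation ν μ := hfl
    _ = ν * (ensembleEnstrophy μ).toReal := rfl
    _ ≤ ν * Λ.longTimeAvg k := mul_le_mul_of_nonneg_left htoReal hν.le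
    _ ≤ ν * longTimeAvgSup k := mul_le_mul_of_nonneg_left hΛk hν.le
    _ = meanDissipation ν u := hdiss.symm

/-- **Ensemble dissipation floors reach every lifted Leray–Hopf path** (the crux for `f ∈ L²`):
ANY generalized limit works, since `Λ(energy means) ≤ limsup = meanEnergy u ≤ E`. -/
theorem meanDissipation_ge_of_ensembleFloor {ν E ε₀ : ℝ} (hν : 0 < ν)
    {f u₀ : UnitAddTorus (Fin 3) → EuclideanSpace ℝ (Fin 3)} (hF : MemLp f 2 volume)
    (hfloor : ∀ μ : Measure (FunctionSpaces.Torus.energySpace (Fin 3)),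
      IsStationaryStatisticalSolution ν f μ →
        Integrable (fun v : FunctionSpaces.Torus.energySpace (Fin 3) => ‖v‖ ^ 2) μ →
          ensembleEnergy μ ≤ E → ε₀ ≤ ensembleDissipation ν μ)
    {u : ℝ → UnitAddTorus (Fin 3) → EuclideanSpace ℝ (Fin 3)}
    (hu : IsGlobalLerayHopf ν (fun _ => f) u₀ u)
    {U : ℝ → FunctionSpaces.Torus.energySpace (Fin 3)}
    (hU : ∀ t, 0 ≤ t →
      (((U t : Lp (EuclideanSpace ℝ (Fin 3)) 2 (volume : Measure (UnitAddTorus (Fin 3)))) :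
        UnitAddTorus (Fin 3) → EuclideanSpace ℝ (Fin 3))) =ᵐ[volume] u t)
    (hE : meanEnergy u ≤ E) :
    ε₀ ≤ meanDissipation ν u := by
  obtain ⟨ρ, hρ0, hρ⟩ := hu.exists_forall_lift_mem_closedBall hν hF hU
  have hgabs : ∀ t, 0 < t → |(fun s => ‖U s‖ ^ 2) t| ≤ ρ := fun t ht => by
    rw [abs_of_nonneg (sq_nonneg _)]
    exact (hρ t ht.le).1
  have hb₁ : IsBoundedUnder (· ≤ ·) atTop (timeMean fun s => ‖U s‖ ^ 2) :=
    isBoundedUnder_le_timeMean hgabs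
  have hb₂ : IsBoundedUnder (· ≥ ·) atTop (timeMean fun s => ‖U s‖ ^ 2) :=
    isBoundedUnder_ge_timeMean hgabs
  obtain ⟨Λ⟩ := (GeneralizedLimit.nonempty_holds : GeneralizedLimit.nonempty)
  have h2 : meanEnergy u = limsup (timeMean fun s => ‖U s‖ ^ 2) atTop := by
    rw [meanEnergy_eq_longTimeAvgSup]
    unfold longTimeAvgSup
    refine limsup_congr (timeMean_eventuallyEq fun t ht => ?_)
    rw [integral_norm_sq_eq_norm_lift_sq hU ht.le, Submodule.coe_norm]
  have hΛE : Λ (timeMean fun s => ‖U s‖ ^ 2) ≤ E :=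
    (Λ.le_limsup hb₁ hb₂).trans (h2 ▸ hE)
  exact meanDissipation_ge_of_ensembleFloor_of_generalizedLimit hν hF hfloor hu hU Λ hΛE

/-! ### The route declaration, concluded BY NAME -/

/-- **`EnsembleRigidity.EnsembleFloorTransfer`** (item stmt-AnomalousDissipation-15511): for `ν > 0`
and a smooth divergence-free mean-zero force `f` on `T³`, if every stationary statistical solution
of NS_ν(f) with integrable energy and `ensembleEnergy ≤ E` has `ensembleDissipation ≥ ε₀`, then
every global Leray–Hopf path `u` with an `H`-valued lift and `meanEnergy u ≤ E` has
`meanDissipation ν u ≥ ε₀`. Specialisation of `meanDissipation_ge_of_ensembleFloor` to a smooth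
force (`IsDivFree f`, `HasZeroMean f` unused: the force enters only through `f ∈ L²`).
[cite: FoiasManleyRosaTemam2001, Ch. IV §3.1 Prop. 3.1, Thm. 3.1, (3.3)–(3.4)] -/
theorem EnsembleFloorTransfer_proof :
    Summit.AnomalousDissipation.AnomalousDissipation.Theses.EnsembleRigidity.EnsembleFloorTransfer := by
  unfold
    Summit.AnomalousDissipation.AnomalousDissipation.Theses.EnsembleRigidity.EnsembleFloorTransfer
  intro ν E ε₀ f u₀ u U hν hfs _hfd _hfz hfloor hu hU hE
  exact meanDissipation_ge_of_ensembleFloor hν (hfs.memLp 2) hfloor hu hU hE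

end Summit.AnomalousDissipation.AnomalousDissipation.Theorems

end
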